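import Summits.Langlands.Langlands.Theses.IrreducibilityBySelfDuality
import Literature.NumberTheory.Automorphic.AdicCompletionLocalField
import Literature.NumberTheory.Automorphic.ReciprocityGLnProofs
import Literature.NumberTheory.Automorphic.HarrisLanTaylorThorneThm713
import Literature.NumberTheory.GaloisRepresentations.LocalGaloisGroup
import Summits.Langlands.Langlands.Theorems.IrreducibilityBySelfDualityGaloisRepOfRegularAlgebraicSatakeGap
import Summits.Langlands.Langlands.Theorems.IrreducibilityBySelfDualityGaloisRepOfRegularAlgebraicGapTransport
import Summits.Langlands.Langlands.Theorems.IrreducibilityBySelfDualityGaloisRepOfRegularAlgebraicMonodromyGap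
import Summits.Langlands.Langlands.Theorems.IrreducibilityBySelfDualityGaloisRepOfRegularAlgebraicInertiaTraces
import Summits.Langlands.Langlands.Theorems.IrreducibilityBySelfDualityGaloisRepOfRegularAlgebraicLocalRigidity

/-!
# Line `Sketch` (generic gap + Weil traces) for crux `GaloisRepOfRegularAlgebraic`
# (stmt-Langlands-10785)

Skeleton owned by the line lead (prover-line-stmt-Langlands-10785-0, continued by
prover-line-stmt-Langlands-10785-c1-0 and -c2-0, 2026-08-16), built on the
ideator-2 sketch `Cruxes/GaloisRepOfRegularAlgebraic/SketchIdeator2.lean` (cards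
`generic-gap-no-monodromy` + `weil-trace-separation`).

THE LINE.  The crux is lang.S27 verbatim (HLTT Thm. A + Varma Cor. 9.3).  In the tree it is
`of_fact ∘ exists_galoisRep_of_regularAlgebraic_of theoremA_existence corollary93_unramified`, the
second leaf standing for Varma's Thm. 1 AND Thm. 2 (`≺`, §9).  This line keeps HLTT's Thm. A as the
existence input (S1) and replaces the Varma leaf by

* S2 `WeilTracesNonzeroDeg` — Varma's **Theorem 1 only**, read at an unramified `π_v` and only on
  the elements of the decomposition group of NON-ZERO Frobenius degree (the elements HLTT's
  twisted-sum separation 7.12 can see; card `weil-trace-separation` is the plan to derive S2 from a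
  Cor.-6.27-genus leaf — a later reshape), in trace form;
* S6 `InertiaTracesOfWeilTraces` — traces on inertia (degree `0`) follow from traces in non-zero
  degree by reading the Cayley–Hamilton recurrence backwards (card B first lemma), PROVABLE;
* S3 `SatakeGap` — no two Satake parameters of the cuspidal `π` at an unramified `v` are in ratio
  `q_v` (Jacquet–Shalika Cor. 2.5 / genericity), S4 `GapTransport` — the gap passes to the roots of
  `arithFrobPolyOfSatake`, S5 `MonodromyGap` — `Φ N = q N Φ` + gap ⇒ `N = 0` (linear algebra),
  and S7 `LocalRigidity` — traces `∑ β^d` on all Frobenius-power elements + gap ⇒ `r` unramified at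
  `v` with Frobenius polynomial `∏ (X - β)` (Grothendieck's monodromy theorem, PROVED in the tree as
  `FramedRep.exists_isOpen_isNilpotent_sub_one_holds`, plus S5), PROVABLE.

Composition `GaloisRepOfRegularAlgebraic_of_statements : S1 → S2 → S3 → S4 → S5 → S6 → (S5 → S7) →
Crux` is kernel-checked below; `GaloisRepOfRegularAlgebraic_of` feeds it the seven `stub_*`.

STATUS (cycle 1, 2026-08-16): S3 p97119, S4 p96570, S5 p96757, S6 p96714, S7 p100031 LANDED (imported
below, no `sorry`); open = the two LEAVES S1 (`theoremA_existence`, HLTT Thm. A) and S2 (Varma Thm. 1,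
trace form; Literature named fact `Varma2024.theorem1_unramified_traces` proposed p98836).  The
conditional closure `of_theoremA_of_weilTraces : S1 → S2 → item` and
`corollary93_unramified_of_weilTraces : S2 → Varma2024.corollary93_unramified` are in
`Theorems/IrreducibilityBySelfDualityGaloisRepOfRegularAlgebraicOfWeilTraces.lean` (p103191).

ROUTE INTEGRATION (route-choice planners, 2026-08-16 13:39–14:15Z): the crux was re-split along this
line — glue item stmt-Langlands-15026 `GaloisRepOfRegularAlgebraicOfLeaves` (= the type of
`of_leaves_of_weilTraces`, closed) over the four leaf items stmt-Langlands-15020 (HLTT Cor. 6.27),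
15021 (Arthur–Clozel archimedean lifting), 15022 (Arthur–Clozel strong cuspidal base change) and
15004 `VarmaWeilTracesUnramified` (= S2 verbatim = Literature fact `Varma2024.theorem1_unramified_traces`
restricted to `d ≠ 0`).  No provable stub of this line remains open.

STATUS (cycle 2, continuation lead prover-line-stmt-Langlands-10785-c1-0, 2026-08-16T19:30Z):
skeleton re-checked (rc 0, sorries = S1, S2 only) and re-registered; the Literature has meanwhile
reduced S2's named fact to the `2n`-dimensional Shimura-variety input
(`Varma2024.theorem1_unramified_traces_of_prop71 : prop71_twoN → AC_arch → AC_cusp → theorem1_unramified_traces`,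
p115556; `Varma2024.prop71_twoN` = Varma Thm. 5.1 + Prop. 7.1, whose clause (b) is Cor. 6.27 again
under the guard `[K:ℚ] = 2 → 2 < n`), so the crux's exact present trust base is FOUR named facts
without `_holds`: `corollary627_splitOrUnramified`, `Varma2024.prop71_twoN`,
`ArthurClozel1989_strongLifting_archimedean`, `ArthurClozel1989_strongLifting_cuspidal` — recorded as
the kernel-checked closure `Theorems.GaloisRepOfRegularAlgebraic.of_namedLeaves`
(`Theorems/IrreducibilityBySelfDualityGaloisRepOfRegularAlgebraicOfNamedLeaves.lean`, registered stub,
p122053).  Every seat on the four leaf items has returned `blocked-on` its named fact with the text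
audited faithful (15020 ×3, 15021, 15022, 15004 ×2).  S1 = `theoremA_existence_of_leaves' h627 harch hBC`,
S2 = `theorem1_unramified_traces_of_prop71 h71 harch hBC` restricted to `d ≠ 0`: both are one-liners
the day the `_holds` land; nothing in this line is provable before that (XL: rigid cohomology of the
ordinary locus of `U(n,n)` Shimura varieties; twisted trace formula).

STATUS (cycle 3, continuation lead prover-line-stmt-Langlands-10785-c2-0, 2026-08-16T19:35Z):
unchanged.  Skeleton re-checked against the current tree (rc 0, sorries = S1, S2 only) and
re-registered from this seat's folder; `Disproof.lean` still v2 (no kill, no `-- Targets` for the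
lead); `lean search` finds no `_holds` for `Varma2024.prop71_twoN`,
`corollary627_splitOrUnramified`, `ArthurClozel1989_strongLifting_archimedean`,
`ArthurClozel1989_strongLifting_cuspidal` (nor for `theoremA_existence` /
`Varma2024.theorem1_unramified_traces`); the leaf items stmt-Langlands-15020/15021/15022/15004
are open, each `blocked-on` its named fact.  Wave: none — the two open stubs are those leaves
(route items with their own seats), not worker-sized statements.  Outcome of the cycle:
`blocked-on: Literature.NumberTheory.Automorphic.Varma2024.prop71_twoN` (apex of the four).

Disproof obligations: `Cruxes/GaloisRepOfRegularAlgebraic/Disproof.lean` v2 (cdisprove, 12:47Z,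
sorry-free) finds NO KILL: the crux is lang.S27 faithfully transcribed (normalisation slips absorbed by
`∃ r`; `n ≤ 1` proved; `n ≥ 2` no constructible datum); its two PROVED negative lemmas
(`Negative/FalseWithoutPrimeToEll.lean` p99994 — the guard `ℓ ∉ v` is load-bearing;
`Negative/FalseWithoutRegularAlgebraic.lean` p102360 — regularity is load-bearing) concern hypotheses
this skeleton keeps, and § Line certifies all seven stubs TRUE as typed (S4's `0 ∉ α` and S7's `0 ∉ β`
redundant, harmless).  Re-read at every turn boundary.  The refuted literal `not_prop712` is not
touched (7.12 is not invoked by this skeleton).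
-/

set_option linter.dupNamespace false
set_option linter.unusedSectionVars false

noncomputable section

open scoped MatrixGroups Matrix NumberField Polynomial
open NumberField IsDedekindDomain Field Polynomial
open Literature.NumberTheory.Automorphic Literature.NumberTheory.GaloisRepresentations
open Literature.NumberTheory.Automorphic.HarrisLanTaylorThorne2016

namespace Summit.Langlands.Langlands.Cruxes.GaloisRepOfRegularAlgebraic.Sketch

/-- The crux under attack, by name. -/
abbrev Crux : Prop :=
  Summit.Langlands.Langlands.Theses.IrreducibilityBySelfDuality.GaloisRepOfRegularAlgebraic

/-! ## The seven stub statements -/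

/-- (S2, LEAF — Varma 2024 Thm. 1 at unramified places, trace form, non-zero degree.)  For `K`
totally real or CM, `π` regular algebraic cuspidal on `GL_n(𝔸_K)`, `r` semisimple with HLTT's
property (`IsCompatible π ι r`, i.e. `r ≅ r_{ℓ,ι}(π)` by Thm. A's uniqueness), `v ∤ ℓ` with `π_v`
unramified of Satake parameter `α`: every `σ ∈ Γ_{K_v}` acting on the residue field as the `d`-th
power of the arithmetic Frobenius, `d ≠ 0`, has `tr r(σ) = ∑_b b^d` over the roots `b` of
`arithFrobPolyOfSatake ι q_v n α`.  This is `(r|_{W_{K_v}})^{ss} ≅ ı⁻¹rec(π_v ⊗ |det|^{(1-n)/2})`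
(Varma, Forum Math. Sigma 12 (2024) e21, Thm. 1; arXiv:1411.2520 Thm. 10.2) read on those elements;
Thm. 2 / `≺` is NOT used.  XL named-fact-backed stub (the sibling card `weil-trace-separation`
proposes to derive it from a Cor.-6.27-genus leaf by `prop712Hausdorff_holds`). -/
def WeilTracesNonzeroDeg : Prop :=
  ∀ {n : ℕ} {K : Type} [Field K] [NumberField K] (hcpt : isCompact_glFiniteIntegralLevel n K),
    IsTotallyReal K ∨ IsCMField K →
    ∀ (π : CuspidalAutomorphicRepData n K hcpt), π.1.IsRegularAlgebraic →
    ∀ (ℓ : ℕ) [Fact ℓ.Prime] (ι : PadicAlgCl ℓ ≃+* ℂ) (r : FramedGaloisRep K (PadicAlgCl ℓ) n),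
      r.toGaloisRep.IsSemisimple → IsCompatible π.1 ι r →
      ∀ (v : HeightOneSpectrum (𝓞 K)), ((ℓ : ℕ) : 𝓞 K) ∉ v.asIdeal →
      ∀ (α : Multiset ℂ), π.1.HasSatakeParamAt v α →
      ∀ (σ : absoluteGaloisGroup (v.adicCompletion K)) (d : ℤ), d ≠ 0 → IsFrobPow σ d →
        (((r.toLocal v) σ : GL (Fin n) (PadicAlgCl ℓ)) : Matrix (Fin n) (Fin n) (PadicAlgCl ℓ)).trace
          = ((arithFrobPolyOfSatake ι v.residueCard n α).roots.map fun b => b ^ d).sum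

/-- (S3, Satake gap.)  For `K` totally real or CM and `π` regular algebraic cuspidal on
`GL_n(𝔸_K)` (Borel–Jacquet datum), at every place `v` where `π` has Satake parameter `α`, no two
entries of `α` are in ratio `q_v`: `a ≠ q_v b`.  Source: `π_v` is generic (Shalika, PROVED in the
tree: `Shalika1974_isGeneric_of_hasLocalComponentAt_holds`) and unitary up to twist, so
Jacquet–Shalika's Cor. (2.5) gives `q_v^{-1/2} < |a|/|c| < q_v^{1/2}` for a common `c`
(`norm_satakeParameter_lt_sqrt_of_isGeneric`; for `n ≥ 3` conditional on the named fact
`JacquetShalika1981_norm_lt_sqrt_of_isGeneric`), and the Borel–Jacquet ↔ `L²` dictionary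
(`CuspidalAutomorphicRepData.exists_satake_eq_cpow_mul_L2_of_realisation`) transports it; the
ratio condition is twist-invariant.  (The totally-real/CM and regularity hypotheses are not needed
mathematically; they are what the composition has in hand.) -/
def SatakeGap : Prop :=
  ∀ {n : ℕ} {K : Type} [Field K] [NumberField K] (hcpt : isCompact_glFiniteIntegralLevel n K),
    IsTotallyReal K ∨ IsCMField K →
    ∀ (π : CuspidalAutomorphicRepData n K hcpt), π.1.IsRegularAlgebraic →
    ∀ (v : HeightOneSpectrum (𝓞 K)) (α : Multiset ℂ), π.1.HasSatakeParamAt v α →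
      ∀ a ∈ α, ∀ b ∈ α, a ≠ (v.residueCard : ℂ) * b

/-- (S4, gap transport, pure algebra.)  The gap `a ≠ q b` on `α` (with `0 ∉ α`, `q > 0`) is the
gap on the roots `ι⁻¹((q^{(n-1)/2} a)⁻¹)` of `arithFrobPolyOfSatake ι q n α`
(`roots_arithFrobPolyOfSatake`): `(ca)⁻¹ = q (cb)⁻¹ ⟺ b = q a`. -/
def GapTransport : Prop :=
  ∀ {ℓ : ℕ} [Fact ℓ.Prime] (ι : PadicAlgCl ℓ ≃+* ℂ) (q n : ℕ), 0 < q →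
    ∀ (α : Multiset ℂ), (0 : ℂ) ∉ α → (∀ a ∈ α, ∀ b ∈ α, a ≠ (q : ℂ) * b) →
    ∀ a ∈ (arithFrobPolyOfSatake ι q n α).roots, ∀ b ∈ (arithFrobPolyOfSatake ι q n α).roots,
      a ≠ (q : PadicAlgCl ℓ) * b

/-- (S5, generic gap kills monodromy, linear algebra.)  Over an algebraically closed field: if
`Φ N = q • N Φ` and no two roots of `charpoly Φ` are in ratio `q` (`a ≠ q b`), then `N = 0` —
`N` maps the generalised `λ`-eigenspace of `Φ` into the generalised `qλ`-eigenspace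
(`(Φ - qλ)^k N = q^k N (Φ - λ)^k`), which is zero, and the generalised eigenspaces span
(Mathlib `Module.End.iSup_maxGenEigenspace_eq_top`).  No nilpotency hypothesis. -/
def MonodromyGap : Prop :=
  ∀ {k : Type} [Field k] [IsAlgClosed k] {n : ℕ} (Φ N : Matrix (Fin n) (Fin n) k) (q : k),
    Φ * N = q • (N * Φ) →
    (∀ a ∈ Φ.charpoly.roots, ∀ b ∈ Φ.charpoly.roots, a ≠ q * b) → N = 0

/-- (S6, inertia traces by backward Cayley–Hamilton.)  `F` a non-archimedean local field,
`ρ : Γ_F → GL_n(k)` any homomorphism, `β` an `n`-element multiset.  If every `σ` of Frobenius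
degree `d ≠ 0` (`IsFrobPow σ d`) has `tr ρ(σ) = ∑ b^d`, then so does every `σ` of degree `0`
(inertia): with `φ` an arithmetic Frobenius (`exists_isFrobPow_holds`), `σ φ^d` has degree `d`
(`IsFrobPow.mul_holds`), so `tr(ρ(σ) ρ(φ)^d) = tr(ρ(φ)^d)` for all `d ≥ 1`; the difference sequence
`u(d) = tr((ρ(σ) - 1) ρ(φ)^d)` obeys the recurrence of `charpoly ρ(φ)` whose constant term
`± det ρ(φ)` is a unit, hence `u(0) = 0`, i.e. `tr ρ(σ) = n = ∑ b^0`. -/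
def InertiaTracesOfWeilTraces : Prop :=
  ∀ {F : Type} [Field F] [ValuativeRel F] [TopologicalSpace F] [IsNonarchimedeanLocalField F]
    {k : Type} [Field k] {n : ℕ} (ρ : absoluteGaloisGroup F →* GL (Fin n) k) (β : Multiset k),
    Multiset.card β = n →
    (∀ (σ : absoluteGaloisGroup F) (d : ℤ), d ≠ 0 → IsFrobPow σ d →
      ((ρ σ : GL (Fin n) k) : Matrix (Fin n) (Fin n) k).trace = (β.map fun b => b ^ d).sum) →
    ∀ (σ : absoluteGaloisGroup F) (d : ℤ), IsFrobPow σ d →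
      ((ρ σ : GL (Fin n) k) : Matrix (Fin n) (Fin n) k).trace = (β.map fun b => b ^ d).sum

/-- (S7, local rigidity — the hardest provable stub, held by the lead.)  `K` a number field,
`v ∤ ℓ`, `r : Γ_K → GL_n(ℚ̄_ℓ)` continuous, `β` an `n`-element multiset of non-zero elements.  If
every `σ ∈ Γ_{K_v}` of Frobenius degree `d` (any `d : ℤ`) has `tr r(σ) = ∑ b^d` and the gap
`a ≠ q_v b` holds on `β`, then `r` is unramified at `v` with arithmetic-Frobenius characteristic
polynomial `∏ (X - b)`.  Proof route (all inputs PROVED in the tree): Grothendieck's monodromy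
theorem `FramedRep.exists_isOpen_isNilpotent_sub_one_holds` / `exists_weilDeligneRep_of_ladic_holds`
on `r|_{W_{K_v}}` (`‖q_v‖ = 1` in `ℚ̄_ℓ` as `v ∤ ℓ`); the Weil–Deligne relation `Φ N Φ⁻¹ = q^{∓1} N`
and Newton (`multiset_eq_of_psum_eq`, `matrix_trace_pow_eq_sum_roots_pow`: the roots of
`charpoly r(Φ)` are `β^{∓1}`) give `N = 0` by S5; so `r` has finite order on inertia
(`exists_pow_mem_of_isOpen`), and a finite-order matrix all of whose powers have trace `n` is `1`;
local-to-global by `isUnramifiedAt_iff_toLocal_holds`, `decompositionSubgroup_adicCompletionPrime_eq_range`,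
`isArithFrobAt_absGaloisRestrict_adicCompletionPrime_iff`, `exists_smul_eq_of_mem_primesAbove_holds`. -/
def LocalRigidity : Prop :=
  ∀ {K : Type} [Field K] [NumberField K] {ℓ : ℕ} [Fact ℓ.Prime] {n : ℕ}
    (v : HeightOneSpectrum (𝓞 K)), ((ℓ : ℕ) : 𝓞 K) ∉ v.asIdeal →
    ∀ (r : FramedGaloisRep K (PadicAlgCl ℓ) n) (β : Multiset (PadicAlgCl ℓ)),
      Multiset.card β = n → (0 : PadicAlgCl ℓ) ∉ β →
      (∀ (σ : absoluteGaloisGroup (v.adicCompletion K)) (d : ℤ), IsFrobPow σ d →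
        (((r.toLocal v) σ : GL (Fin n) (PadicAlgCl ℓ)) : Matrix (Fin n) (Fin n) (PadicAlgCl ℓ)).trace
          = (β.map fun b => b ^ d).sum) →
      (∀ a ∈ β, ∀ b ∈ β, a ≠ (v.residueCard : PadicAlgCl ℓ) * b) →
      r.IsUnramifiedAt v ∧ r.HasFrobCharpolyAt v ((β.map fun b => X - C b).prod)

/-! ## Registered stubs (each stated in full; `sorry` lives only here) -/

/-- S1 = `theoremA_existence` (Harris–Lan–Taylor–Thorne 2016 Thm. A, existence; XL named fact of
the tree — `ReciprocityGLnProofs`; reduced in the tree to Cor. 6.27 + Arthur–Clozel's archimedean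
clause + strong prime-degree base change by `theoremA_existence_of_leaves'`).  LEAF: this stub is
`blocked-on` the named fact and is not attacked by this line. -/
theorem stub_theoremA :
    ∀ {n : ℕ} {K : Type} [Field K] [NumberField K] (hcpt : isCompact_glFiniteIntegralLevel n K),
      IsTotallyReal K ∨ IsCMField K →
      ∀ (π : CuspidalAutomorphicRepData n K hcpt), π.1.IsRegularAlgebraic → ∀ (ℓ : ℕ) [Fact ℓ.Prime]
        (ι : PadicAlgCl ℓ ≃+* ℂ),
        ∃ r : FramedGaloisRep K (PadicAlgCl ℓ) n, r.toGaloisRep.IsSemisimple ∧ IsCompatible π.1 ι r := by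
  sorry

/-- S2 = `WeilTracesNonzeroDeg` (Varma 2024 Thm. 1 at unramified `π_v`, non-zero degree, trace
form; XL named-fact-backed LEAF). -/
theorem stub_weilTracesNonzeroDeg :
    ∀ {n : ℕ} {K : Type} [Field K] [NumberField K] (hcpt : isCompact_glFiniteIntegralLevel n K),
      IsTotallyReal K ∨ IsCMField K →
      ∀ (π : CuspidalAutomorphicRepData n K hcpt), π.1.IsRegularAlgebraic →
      ∀ (ℓ : ℕ) [Fact ℓ.Prime] (ι : PadicAlgCl ℓ ≃+* ℂ) (r : FramedGaloisRep K (PadicAlgCl ℓ) n),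
        r.toGaloisRep.IsSemisimple → IsCompatible π.1 ι r →
        ∀ (v : HeightOneSpectrum (𝓞 K)), ((ℓ : ℕ) : 𝓞 K) ∉ v.asIdeal →
        ∀ (α : Multiset ℂ), π.1.HasSatakeParamAt v α →
        ∀ (σ : absoluteGaloisGroup (v.adicCompletion K)) (d : ℤ), d ≠ 0 → IsFrobPow σ d →
          (((r.toLocal v) σ : GL (Fin n) (PadicAlgCl ℓ)) : Matrix (Fin n) (Fin n) (PadicAlgCl ℓ)).trace
            = ((arithFrobPolyOfSatake ι v.residueCard n α).roots.map fun b => b ^ d).sum := by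
  sorry

/-- S3 = `SatakeGap` (JS Cor. 2.5 / genericity + BJ ↔ `L²` dictionary; size M–L; for `n ≥ 3`
expected conditional on `JacquetShalika1981_norm_lt_sqrt_of_isGeneric`). -/
theorem stub_satakeGap :
    ∀ {n : ℕ} {K : Type} [Field K] [NumberField K] (hcpt : isCompact_glFiniteIntegralLevel n K),
      IsTotallyReal K ∨ IsCMField K →
      ∀ (π : CuspidalAutomorphicRepData n K hcpt), π.1.IsRegularAlgebraic →
      ∀ (v : HeightOneSpectrum (𝓞 K)) (α : Multiset ℂ), π.1.HasSatakeParamAt v α →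
        ∀ a ∈ α, ∀ b ∈ α, a ≠ (v.residueCard : ℂ) * b :=
  -- LANDED (p97119): Theorems/IrreducibilityBySelfDualityGaloisRepOfRegularAlgebraicSatakeGap.lean
  Summit.Langlands.Langlands.Theorems.GaloisRepOfRegularAlgebraic.stub_satakeGap

/-- S4 = `GapTransport` (size S). -/
theorem stub_gapTransport :
    ∀ {ℓ : ℕ} [Fact ℓ.Prime] (ι : PadicAlgCl ℓ ≃+* ℂ) (q n : ℕ), 0 < q →
      ∀ (α : Multiset ℂ), (0 : ℂ) ∉ α → (∀ a ∈ α, ∀ b ∈ α, a ≠ (q : ℂ) * b) →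
      ∀ a ∈ (arithFrobPolyOfSatake ι q n α).roots, ∀ b ∈ (arithFrobPolyOfSatake ι q n α).roots,
        a ≠ (q : PadicAlgCl ℓ) * b :=
  -- LANDED (p96570): Theorems/IrreducibilityBySelfDualityGaloisRepOfRegularAlgebraicGapTransport.lean
  Summit.Langlands.Langlands.Theorems.GaloisRepOfRegularAlgebraic.stub_gapTransport

/-- S5 = `MonodromyGap` (size M, Mathlib generalised eigenspaces). -/
theorem stub_monodromyGap :
    ∀ {k : Type} [Field k] [IsAlgClosed k] {n : ℕ} (Φ N : Matrix (Fin n) (Fin n) k) (q : k),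
      Φ * N = q • (N * Φ) →
      (∀ a ∈ Φ.charpoly.roots, ∀ b ∈ Φ.charpoly.roots, a ≠ q * b) → N = 0 :=
  -- LANDED (p96757): Theorems/IrreducibilityBySelfDualityGaloisRepOfRegularAlgebraicMonodromyGap.lean
  Summit.Langlands.Langlands.Theorems.GaloisRepOfRegularAlgebraic.stub_monodromyGap

/-- S6 = `InertiaTracesOfWeilTraces` (size S–M; `exists_isFrobPow_holds`, `IsFrobPow.mul_holds`,
Cayley–Hamilton `Matrix.aeval_self_charpoly`). -/
theorem stub_inertiaTraces :
    ∀ {F : Type} [Field F] [ValuativeRel F] [TopologicalSpace F] [IsNonarchimedeanLocalField F]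
      {k : Type} [Field k] {n : ℕ} (ρ : absoluteGaloisGroup F →* GL (Fin n) k) (β : Multiset k),
      Multiset.card β = n →
      (∀ (σ : absoluteGaloisGroup F) (d : ℤ), d ≠ 0 → IsFrobPow σ d →
        ((ρ σ : GL (Fin n) k) : Matrix (Fin n) (Fin n) k).trace = (β.map fun b => b ^ d).sum) →
      ∀ (σ : absoluteGaloisGroup F) (d : ℤ), IsFrobPow σ d →
        ((ρ σ : GL (Fin n) k) : Matrix (Fin n) (Fin n) k).trace = (β.map fun b => b ^ d).sum :=
  -- LANDED (p96714): Theorems/IrreducibilityBySelfDualityGaloisRepOfRegularAlgebraicInertiaTraces.lean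
  Summit.Langlands.Langlands.Theorems.GaloisRepOfRegularAlgebraic.stub_inertiaTraces

/-- S7 = `MonodromyGap → LocalRigidity` (size L; held by the line lead; the antecedent is S5 stated
in full, so that the landed stub file needs no definition of this skeleton). -/
theorem stub_localRigidity :
    (∀ {k : Type} [Field k] [IsAlgClosed k] {n : ℕ} (Φ N : Matrix (Fin n) (Fin n) k) (q : k),
      Φ * N = q • (N * Φ) →
      (∀ a ∈ Φ.charpoly.roots, ∀ b ∈ Φ.charpoly.roots, a ≠ q * b) → N = 0) →
    ∀ {K : Type} [Field K] [NumberField K] {ℓ : ℕ} [Fact ℓ.Prime] {n : ℕ}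
      (v : HeightOneSpectrum (𝓞 K)), ((ℓ : ℕ) : 𝓞 K) ∉ v.asIdeal →
      ∀ (r : FramedGaloisRep K (PadicAlgCl ℓ) n) (β : Multiset (PadicAlgCl ℓ)),
        Multiset.card β = n → (0 : PadicAlgCl ℓ) ∉ β →
        (∀ (σ : absoluteGaloisGroup (v.adicCompletion K)) (d : ℤ), IsFrobPow σ d →
          (((r.toLocal v) σ : GL (Fin n) (PadicAlgCl ℓ)) : Matrix (Fin n) (Fin n) (PadicAlgCl ℓ)).trace
            = (β.map fun b => b ^ d).sum) →
        (∀ a ∈ β, ∀ b ∈ β, a ≠ (v.residueCard : PadicAlgCl ℓ) * b) →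
        r.IsUnramifiedAt v ∧ r.HasFrobCharpolyAt v ((β.map fun b => X - C b).prod) :=
  -- LANDED (p100031): Theorems/IrreducibilityBySelfDualityGaloisRepOfRegularAlgebraicLocalRigidity.lean
  Summit.Langlands.Langlands.Theorems.GaloisRepOfRegularAlgebraic.stub_localRigidity

/-! ## The composition (kernel-checked) -/

/-- **The crux from the seven statements.**  Take `r` from Thm. A (S1).  At `v ∤ ℓ` where `π` has
Satake parameter `α`, let `β` be the roots of `arithFrobPolyOfSatake ι q_v n α` (`n` of them,
`card_roots_arithFrobPolyOfSatake`; non-zero, `zero_not_mem_roots_arithFrobPolyOfSatake`, since the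
gap S3 at `a = b = 0` excludes `0 ∈ α`).  S2 gives the traces `∑ β^d` in non-zero degree, S6 extends
them to inertia, S3+S4 give the gap on `β`, and S7 (fed with S5) concludes; finally
`arithFrobPolyOfSatake_eq_prod_roots`. -/
theorem GaloisRepOfRegularAlgebraic_of_statements
    (h1 : theoremA_existence) (h2 : WeilTracesNonzeroDeg) (h3 : SatakeGap) (h4 : GapTransport)
    (h5 : MonodromyGap) (h6 : InertiaTracesOfWeilTraces) (h7 : MonodromyGap → LocalRigidity) :
    Crux := by
  intro n K _ _ hcpt hK π hπ ℓ _ ι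
  obtain ⟨r, hr, hc⟩ := h1 hcpt hK π hπ ℓ ι
  refine ⟨r, hr, fun v α hα hv => ?_⟩
  -- the data at `v`
  have hq : 0 < v.residueCard := lt_trans zero_lt_one v.one_lt_residueCard
  have hgapα : ∀ a ∈ α, ∀ b ∈ α, a ≠ (v.residueCard : ℂ) * b := h3 hcpt hK π hπ v α hα
  have hα0 : (0 : ℂ) ∉ α := fun h0 => hgapα 0 h0 0 h0 (by rw [mul_zero])
  set β : Multiset (PadicAlgCl ℓ) := (arithFrobPolyOfSatake ι v.residueCard n α).roots with hβdef
  have hβn : Multiset.card β = n := by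
    rw [hβdef, card_roots_arithFrobPolyOfSatake, hα.card_eq]
  have hβ0 : (0 : PadicAlgCl ℓ) ∉ β :=
    zero_not_mem_roots_arithFrobPolyOfSatake ι hq n fun a ha h => hα0 (h ▸ ha)
  have hgapβ : ∀ a ∈ β, ∀ b ∈ β, a ≠ (v.residueCard : PadicAlgCl ℓ) * b :=
    h4 ι v.residueCard n hq α hα0 hgapα
  -- traces in non-zero degree (S2), then in all degrees (S6)
  have htr0 : ∀ (σ : absoluteGaloisGroup (v.adicCompletion K)) (d : ℤ), d ≠ 0 → IsFrobPow σ d →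
      (((r.toLocal v).toMonoidHom σ : GL (Fin n) (PadicAlgCl ℓ)) :
          Matrix (Fin n) (Fin n) (PadicAlgCl ℓ)).trace = (β.map fun b => b ^ d).sum :=
    fun σ d hd hσ => h2 hcpt hK π hπ ℓ ι r hr hc v hv α hα σ d hd hσ
  have htr : ∀ (σ : absoluteGaloisGroup (v.adicCompletion K)) (d : ℤ), IsFrobPow σ d →
      (((r.toLocal v) σ : GL (Fin n) (PadicAlgCl ℓ)) : Matrix (Fin n) (Fin n) (PadicAlgCl ℓ)).trace
        = (β.map fun b => b ^ d).sum :=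
    fun σ d hσ => h6 (r.toLocal v).toMonoidHom β hβn htr0 σ d hσ
  -- local rigidity (S7 fed with S5)
  obtain ⟨hunr, hfrob⟩ := h7 h5 v hv r β hβn hβ0 htr hgapβ
  refine ⟨hunr, ?_⟩
  rw [arithFrobPolyOfSatake_eq_prod_roots]
  exact hfrob

/-- **The skeleton theorem**: the crux `GaloisRepOfRegularAlgebraic`, BY NAME, from the seven
registered stubs (`sorry` lives only inside `stub_*`; when the stubs land this is the crux proof,
conditional on the leaves S1, S2). -/
theorem GaloisRepOfRegularAlgebraic_of :
    Summit.Langlands.Langlands.Theses.IrreducibilityBySelfDuality.GaloisRepOfRegularAlgebraic :=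
  GaloisRepOfRegularAlgebraic_of_statements stub_theoremA stub_weilTracesNonzeroDeg stub_satakeGap
    stub_gapTransport stub_monodromyGap stub_inertiaTraces stub_localRigidity

end Summit.Langlands.Langlands.Cruxes.GaloisRepOfRegularAlgebraic.Sketch

end
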